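import Summits.RiemannHypothesis.RiemannHypothesis.Theorems.Splittings.LinearRayLehmerWindowQ
import Summits.RiemannHypothesis.RiemannHypothesis.Theorems.Splittings.LinearRayLehmerWindowDip
import Summits.RiemannHypothesis.RiemannHypothesis.Theorems.Splittings.LinearRayLehmerWindowCertDip
import Summits.RiemannHypothesis.RiemannHypothesis.Theorems.Splittings.LinearRayLehmerWindowCertLow
import Summits.RiemannHypothesis.RiemannHypothesis.Theorems.Splittings.LinearRayLehmerWindowCertHigh
import Summits.RiemannHypothesis.RiemannHypothesis.Theorems.UniversalFactorLinearRayLehmerWindow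
import HarnessLib

/-!
# The linear-factor ray is refuted for every `1 ≤ |a| ≤ 21` (Lehmer's pair, two-point certificate)

Cell rh-split (D-0116 arm), ENGINE 5 (rh-splitx-eng-5 g4), lane (xviii-D) «LEHMER WINDOW DATA» — the
cell's RH-free TARGET T14: the numerical `LehmerWindowData` of the glue file
`Theorems/UniversalFactorLinearRayLehmerWindow.lean` (dbn-neg g2) SUPPLIED, for every `a ∈ [1, 21]`, from the
three compiled certificates (`ldDip_check`, `ldLow_check`, `ldHigh_check`) and their soundness theorems
(`ldDipRunWith_sound`, `ldQRunWith_sound`), and fed to the tree's derivative-free two-point certificate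
`Splittings.LinearRayTwoPoint.not_linearRay_certificate_scaled` with the common scale `κ = K₀ = lehmerK0 t₀`:
`x₀ = 2t₀ = 14010.16`, `x = x₀ − 9/250`, `0 < H_0(x)`, `H_0(x₀) < 0` (the engine's `stub_highWindow` via the
glue's `lehmer_signs`), `K₀ q ≤ Q_a(x₀)`, `−K₀ M ≤ H_0` on `[x, x₀]`, `(9/250)·M < e^{−9a/250} q`.
Main results: `not_hasOnlyRealZeros_linearFactorH_of_mem_Icc` (`a ∈ [1, 21]`) and the `|a|` form
`not_hasOnlyRealZeros_linearFactorH_of_abs_mem_Icc`; with the tree's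
`Splittings.LinearRayOnePoint.not_hasOnlyRealZeros_linearFactorH_of_abs_le_seven_tenths` the linear-factor ray
of `Literature/Barriers/RiemannHypothesis/NewmanConjecture.lean` is now refuted in the kernel for every
`0 < |a| ≤ 7/10` and every `1 ≤ |a| ≤ 21`; OPEN: `7/10 < |a| < 1` and `|a| > 21`.
Axioms: `propext`, `Classical.choice`, `Quot.sound` + the declared `native_decide` axioms of the three
certificate files and of the engine's `hiWin1_check` (through `lehmer_signs`).
HONEST LABEL: the ray is RH-STRENGTHENING (`riemannHypothesis_of_exists_linearRay`); refuting it on a window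
is RH-free negative-side bookkeeping for the C15 census — not a splitting; nothing here bears on the truth of RH.
-/

set_option linter.dupNamespace false

noncomputable section

namespace Summit.RiemannHypothesis.RiemannHypothesis.Theorems.Splittings.LinearRayLehmerWindow

open Set MeasureTheory
open Literature.NumberTheory.LFunctions Literature.NumberTheory.LFunctions.ZetaNumerics
open Literature.Barriers.RiemannHypothesis (linearFactorH)
open Summit.RiemannHypothesis.RiemannHypothesis.Theorems.Splittings.LinearRayTwoPoint

/-- The engine's `ζ` tables are valid. [folklore] -/
theorem lehmerTables_valid : ∀ T : Tables, UniversalFactor.lehmerTables = some T → T.Valid :=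
  fun T hT => by unfold UniversalFactor.lehmerTables at hT; exact mkTables_valid hT

/-- **The glue step at Lehmer's pair for any `a > 0`**: scale-free data `(L, M, q)` in `K₀` units —
`0 < H_0(x₀ − L)`, `K₀ q ≤ Q_a(x₀)`, `−K₀ M ≤ H_0` on `[x₀ − L, x₀]`, `L·M < e^{−aL} q` — refute the ray at
`a` (the fourth fact `H_0(x₀) < 0` is the glue's `lehmer_signs`). [folklore] -/
theorem not_linearRay_of_data {a L M q : ℝ} (ha : 0 < a) (hL0 : 0 ≤ L) (hL : L ≤ 2 * UniversalFactor.lehmerT0)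
    (hM0 : 0 ≤ M) (hHx : 0 < (deBruijnH 0 ((2 * UniversalFactor.lehmerT0 - L : ℝ) : ℂ)).re)
    (hq : UniversalFactor.lehmerK0 UniversalFactor.lehmerT0 * q ≤
      (∫ y in Ioi (0:ℝ), deBruijnH 0 (((2 * UniversalFactor.lehmerT0 : ℝ) : ℂ) + y) * (Real.exp (-(a * y)) : ℂ)).re)
    (hM : ∀ r ∈ Icc (2 * UniversalFactor.lehmerT0 - L) (2 * UniversalFactor.lehmerT0),
      -(UniversalFactor.lehmerK0 UniversalFactor.lehmerT0 * M) ≤ (deBruijnH 0 (r : ℂ)).re)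
    (hmargin : L * M < Real.exp (-(a * L)) * q) : ¬ HasOnlyRealZeros (linearFactorH a) := by
  have hHx' := (UniversalFactorLinearRayLehmerWindow.lehmer_signs (a := 3 / 2) ⟨le_rfl, by norm_num⟩).1
  have hK := UniversalFactor.lehmerK0_pos UniversalFactor.lehmerT0
  have e : 2 * UniversalFactor.lehmerT0 - (2 * UniversalFactor.lehmerT0 - L) = L := by ring
  refine not_linearRay_certificate_scaled (x := 2 * UniversalFactor.lehmerT0 - L) (x' := 2 * UniversalFactor.lehmerT0)
    ha (by linarith) (by linarith) hK hHx hHx' hq hM0 hM ?_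
  rw [e]; exact hmargin

/-- The dip data of record: `0 < H_0(x₀ − 9/250)` and `−K₀·219000 ≤ H_0` on `[x₀ − 9/250, x₀]`
(`K₀`-free units), from `ldDip_check`. [folklore] -/
theorem dip_data :
    0 < (deBruijnH 0 ((2 * UniversalFactor.lehmerT0 - (9 : ℕ) / (250 : ℕ) : ℝ) : ℂ)).re ∧
    ∀ r ∈ Icc (2 * UniversalFactor.lehmerT0 - (9 : ℕ) / (250 : ℕ)) (2 * UniversalFactor.lehmerT0),
      -(UniversalFactor.lehmerK0 UniversalFactor.lehmerT0 * ((219000 : ℚ) : ℝ)) ≤ (deBruijnH 0 (r : ℂ)).re := by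
  have h := ldDipRunWith_sound (oT := UniversalFactor.lehmerTables) lehmerTables_valid rfl ldDip_check
  have e : (2 * UniversalFactor.lehmerT0 - 2 * (((720 : ℕ) : ℝ) / ((40000 : ℕ) : ℝ))) =
      2 * UniversalFactor.lehmerT0 - ((9 : ℕ) : ℝ) / ((250 : ℕ) : ℝ) := by norm_num
  rw [e] at h
  exact h

/-- **The linear-factor ray is refuted for `1 ≤ a ≤ 4`.** [folklore] -/
theorem not_hasOnlyRealZeros_linearFactorH_low {a : ℝ} (ha : a ∈ Icc (1:ℝ) 4) :
    ¬ HasOnlyRealZeros (linearFactorH a) := by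
  obtain ⟨hM0, q, -, hq, hmargin⟩ := ldQRunWith_sound (oT := UniversalFactor.lehmerTables) lehmerTables_valid
    ldLow_check (a := a)
    (by simp only [ldAsLow, List.getD_cons_zero]; push_cast; linarith [ha.1])
    (by simp only [ldAsLow, List.length_cons, List.length_nil, List.getD_cons_succ, List.getD_cons_zero]
        push_cast; linarith [ha.2])
  obtain ⟨hHx, hM⟩ := dip_data
  exact not_linearRay_of_data (by linarith [ha.1]) (by positivity)
    (by have := lehmerT0_bounds; push_cast; linarith) (by exact_mod_cast hM0) hHx hq hM hmargin

/-- **The linear-factor ray is refuted for `4 ≤ a ≤ 21`.** [folklore] -/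
theorem not_hasOnlyRealZeros_linearFactorH_high {a : ℝ} (ha : a ∈ Icc (4:ℝ) 21) :
    ¬ HasOnlyRealZeros (linearFactorH a) := by
  obtain ⟨hM0, q, -, hq, hmargin⟩ := ldQRunWith_sound (oT := UniversalFactor.lehmerTables) lehmerTables_valid
    ldHigh_check (a := a)
    (by simp only [ldAsHigh, List.getD_cons_zero]; push_cast; linarith [ha.1])
    (by simp only [ldAsHigh, List.length_cons, List.length_nil, List.getD_cons_succ, List.getD_cons_zero]
        push_cast; linarith [ha.2])
  obtain ⟨hHx, hM⟩ := dip_data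
  exact not_linearRay_of_data (by linarith [ha.1]) (by positivity)
    (by have := lehmerT0_bounds; push_cast; linarith) (by exact_mod_cast hM0) hHx hq hM hmargin

/-- **Main theorem.** For every `a ∈ [1, 21]` the linear-factor deformation `linearFactorH a` of
`H_0 = deBruijnH 0` has a zero off the real axis: the linear-factor ray of
`Literature/Barriers/RiemannHypothesis/NewmanConjecture.lean` is refuted on `[1, 21]` (RH-free; Lehmer's
pair `γ ≈ 7005.06, 7005.10`, derivative-free two-point certificate). [folklore] -/
theorem not_hasOnlyRealZeros_linearFactorH_of_mem_Icc {a : ℝ} (ha : a ∈ Icc (1:ℝ) 21) :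
    ¬ HasOnlyRealZeros (linearFactorH a) := by
  by_cases h4 : a ≤ 4
  · exact not_hasOnlyRealZeros_linearFactorH_low ⟨ha.1, h4⟩
  · exact not_hasOnlyRealZeros_linearFactorH_high ⟨(not_le.1 h4).le, ha.2⟩

/-- The same with an explicit non-real zero. [folklore] -/
theorem exists_nonreal_zero_linearFactorH_of_mem_Icc {a : ℝ} (ha : a ∈ Icc (1:ℝ) 21) :
    ∃ z : ℂ, linearFactorH a z = 0 ∧ z.im ≠ 0 := by
  have h := not_hasOnlyRealZeros_linearFactorH_of_mem_Icc ha
  simp only [HasOnlyRealZeros, not_forall, exists_prop] at h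
  obtain ⟨z, hz, hzim⟩ := h
  exact ⟨z, hz, hzim⟩

/-- **Mirror form**: for every real `a` with `1 ≤ |a| ≤ 21`, `linearFactorH a` has a non-real zero
(`G_{−a}(z) = G_a(−z)`, `hasOnlyRealZeros_linearFactorH_neg_iff`). [folklore] -/
theorem not_hasOnlyRealZeros_linearFactorH_of_abs_mem_Icc {a : ℝ} (h1 : 1 ≤ |a|) (h2 : |a| ≤ 21) :
    ¬ HasOnlyRealZeros (linearFactorH a) := by
  rcases le_or_gt 0 a with ha | ha
  · rw [abs_of_nonneg ha] at h1 h2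
    exact not_hasOnlyRealZeros_linearFactorH_of_mem_Icc ⟨h1, h2⟩
  · rw [abs_of_neg ha] at h1 h2
    rw [← Literature.Barriers.RiemannHypothesis.hasOnlyRealZeros_linearFactorH_neg_iff]
    exact not_hasOnlyRealZeros_linearFactorH_of_mem_Icc ⟨h1, h2⟩

end Summit.RiemannHypothesis.RiemannHypothesis.Theorems.Splittings.LinearRayLehmerWindow

end
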